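import Literature.AlgebraicGeometry.Motives.MixedHodgeStructureCatWeightGradedObject
import HarnessLib

/-!
# The associated weight-graded MHS, II: Hodge numbers, and Hodge classes `Hdgᵖ(X) ↪ Hdgᵖ(grTotal X) = Hdgᵖ(Gr^W_{2p} X)`

Layer `Literature/AlgebraicGeometry/Motives` (lane `lit-hodgefound`), sequel to g44-#12 (`Motives/MixedHodgeStructureCatWeightGradedObject`: the functor
`grTotal s X = ⨁_{j ∈ s} (ofPure j)(Gr^W_j X)`, its weights, `grGrTotalObjIso`, length, composition multiplicities, semisimplicity).  Here:

* §1 **Hodge numbers `h^{p,q}((grTotal s) X) = h^{p,q}(X)`** (`p + q ∈ s`, or `s ⊇` weights of `X`; through g44-#12 `grGrTotalObjIso`);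
* §2 **Hodge classes**: `Hdgᵖ` is additive, so `Hdgᵖ((grTotal s) X) ≅ Hdgᵖ((ofPure 2p)(Gr^W_{2p} X))` (`2p ∈ s`; the other summands have no
  classes of type `(p,p)`), and the canonical comparison **`hodgeClassesToGrTotal : hodgeClassesFunctor p ⟶ grTotal s ⋙ hodgeClassesFunctor p`**
  (through the `2p`-summand, g43 `hodgeClassesToGr`) is a MONOMORPHISM, an isomorphism at `X` with `W_{2p-1} X = 0`: the associated graded has
  at least as many Hodge classes as `X`.

Everything is PROVED; definitions with bodies; no named fact, no instance, no notation; `[HasFiniteBiproducts MixedHodgeStructureCat]` and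
`[∀ n, HasFiniteBiproducts (HodgeStructureCat n)]` are carried as hypotheses (the tree's theorems `hasFiniteBiproducts`).

Sources, verbatim.  E. Cattani, F. El Zein, P. A. Griffiths, Lê D. T. (eds.), *Hodge Theory* (2014) [CattaniElZeinGriffithsLe2014] (held text
`book:cattani2014-hodge-theory-princeton-mathematical-notes-49`): Cor. 3.2.21 (ii) (p0161 L14) «The functor `Gr^W_n` from the category of MHS to
the category `A ⊗ ℚ` HS of weight `n` is exact», §3.2.2.6 (p0162 L14–L20) «The Hodge numbers of H are the Hodge numbers of the Hodge structure on
`Gr^W_{p+q} H`», Ex. 3.2.23 (1)–(2) (p0162–p0163).  D. Arapura, *Hodge cycles and the Leray filtration* [Arapura2022], §1 Lemma 1.1 (Hodge cycles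
of an MHS inject into those of `Gr^W_{2p}`; cited through the tree's `MixedHodgeStructureHodgeClasses` ∕ `…CatHodgeClassesGr`).

## Main definitions and results

* §1 `hodgeNumber_eq_of_gr_iso`, **`hodgeNumber_grTotal_obj`**, `hodgeNumber_grTotal_obj_of_subset`.
* §2 `isZero_hodgeClassesFunctor_obj_ofPure_gr_of_ne`, **`hodgeClassesGrTotalObjIso`** (+ `_hom`), **`hodgeClassesToGrTotal`** (+ `_app`),
  `hodgeClassesToGrTotal_app_comp`, `mono_hodgeClassesToGrTotal_app`, `mono_hodgeClassesToGrTotal`, `isIso_hodgeClassesToGrTotal_app`.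

## References

* [CattaniElZeinGriffithsLe2014] E. Cattani et al. (eds.), Hodge Theory, Princeton Math. Notes 49 (2014), Cor. 3.2.21 (ii), §3.2.2.6, Ex. 3.2.23.
* [Arapura2022] D. Arapura, Hodge cycles and the Leray filtration, Pacific J. Math. 319 (2022), §1, Lemma 1.1.
* [DeligneHodgeII1971] P. Deligne, Théorie de Hodge II, Publ. Math. IHÉS 40 (1971), Déf. 2.3.1, Thm. 2.3.5.

## Provenance

Lane `lit-hodgefound` (summit `HodgeConjecture`), seat `lit-hodgefound-p36` (literature-prover, generation 44, row g44-#13).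
-/

noncomputable section

open CategoryTheory CategoryTheory.Limits

namespace Literature.AlgebraicGeometry.Motives

universe u

namespace MixedHodgeStructureCat

section

variable [HasFiniteBiproducts MixedHodgeStructureCat.{u}] (s : Finset ℤ)

omit [HasFiniteBiproducts MixedHodgeStructureCat.{u}] s in
/-- In a biproduct whose summands other than the `k`-th are zero, the `k`-th projection is an isomorphism. [folklore] -/
private theorem isIso_biproduct_π_of_isZero' {C : Type*} [Category C] [Preadditive C] {J : Type} [Fintype J] (G : J → C) [HasBiproduct G]
    (k : J) (h : ∀ j, j ≠ k → IsZero (G j)) : IsIso (biproduct.π G k) :=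
  ⟨⟨biproduct.ι G k, by
    rw [← biproduct.total, Finset.sum_eq_single_of_mem k (Finset.mem_univ k) fun j _ hj => by
      rw [(h j hj).eq_of_tgt (biproduct.π G j) 0, zero_comp]], biproduct.ι_π_self G k⟩⟩

/-! ## §1 Hodge numbers -/

omit [HasFiniteBiproducts MixedHodgeStructureCat.{u}] s in
/-- Isomorphic `Gr^W_{p+q}` ⟹ equal Hodge numbers `h^{p,q}`. [cite: CattaniElZeinGriffithsLe2014, §3.2.2.6 and Thm. 3.2.18 (proof)] -/
theorem hodgeNumber_eq_of_gr_iso {X Y : MixedHodgeStructureCat.{u}} {p q : ℤ} (e : (gr (p + q)).obj X ≅ (gr (p + q)).obj Y) :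
    X.str.hodgeNumber p q = Y.str.hodgeNumber p q := by
  rw [hodgeNumber_eq_gr_obj X, hodgeNumber_eq_gr_obj Y]
  exact HodgeStructure.Hom.hodgeNumber_eq_of_bijective e.hom ((HodgeStructureCat.isIso_iff_bijective e.hom).1 inferInstance) p q

/-- **`h^{p,q}((grTotal s) X) = h^{p,q}(X)` for `p + q ∈ s`.** [cite: CattaniElZeinGriffithsLe2014, §3.2.2.6 and Cor. 3.2.21 (ii)] -/
theorem hodgeNumber_grTotal_obj [∀ n : ℤ, HasFiniteBiproducts (HodgeStructureCat.{u} n)] {p q : ℤ} (h : p + q ∈ s) (X : MixedHodgeStructureCat.{u}) :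
    ((grTotal s).obj X).str.hodgeNumber p q = X.str.hodgeNumber p q :=
  hodgeNumber_eq_of_gr_iso (grGrTotalObjIso s ⟨p + q, h⟩ X)

/-- **`h^{p,q}((grTotal s) X) = h^{p,q}(X)` for all `p, q` when `s ⊇` (weights of `X`)** (for `p + q ∉ s` both graded pieces vanish).
[cite: CattaniElZeinGriffithsLe2014, §3.2.2.6 and Cor. 3.2.21 (ii)] -/
theorem hodgeNumber_grTotal_obj_of_subset [∀ n : ℤ, HasFiniteBiproducts (HodgeStructureCat.{u} n)] {X : MixedHodgeStructureCat.{u}}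
    (hs : ∀ ⦃j⦄, X.str.IsWeight j → j ∈ s) (p q : ℤ) : ((grTotal s).obj X).str.hodgeNumber p q = X.str.hodgeNumber p q := by
  by_cases h : p + q ∈ s
  · exact hodgeNumber_grTotal_obj s h X
  · exact hodgeNumber_eq_of_gr_iso ((isZero_gr_obj_grTotal_obj s h X).iso ((isZero_gr_obj_iff_not_isWeight _ X).2 fun hw => h (hs hw)))

/-! ## §2 Hodge classes -/

omit [HasFiniteBiproducts MixedHodgeStructureCat.{u}] s in
/-- `Hdgᵖ((ofPure j)(Gr^W_j X)) = 0` for `j ≠ 2p`. [cite: Arapura2022, §1 Lemma 1.1] [cite: CattaniElZeinGriffithsLe2014, Ex. 3.2.23 (1)] -/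
theorem isZero_hodgeClassesFunctor_obj_ofPure_gr_of_ne {p j : ℤ} (h : j ≠ 2 * p) (X : MixedHodgeStructureCat.{u}) :
    IsZero ((hodgeClassesFunctor p).obj ((ofPure j).obj ((gr j).obj X))) :=
  isZero_hodgeClassesFunctor_obj_of_not_isWeight p fun hw => h (Set.mem_singleton_iff.1 (weightsIn_ofPure_gr_obj j X hw)).symm

/-- **`Hdgᵖ((grTotal s) X) ≅ Hdgᵖ((ofPure 2p)(Gr^W_{2p} X))` for `2p ∈ s`**: `Hdgᵖ` is additive, and the summands of weight `≠ 2p` carry no classes of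
type `(p,p)`. [cite: Arapura2022, §1 Lemma 1.1] [cite: CattaniElZeinGriffithsLe2014, Ex. 3.2.23 (1)–(2)] -/
def hodgeClassesGrTotalObjIso (p : ℤ) (hp : 2 * p ∈ s) (X : MixedHodgeStructureCat.{u}) :
    (hodgeClassesFunctor p).obj ((grTotal s).obj X) ≅ (hodgeClassesFunctor p).obj ((ofPure (2 * p)).obj ((gr (2 * p)).obj X)) :=
  (hodgeClassesFunctor p).mapBiproduct (fun i : s => (ofPure (i : ℤ)).obj ((gr (i : ℤ)).obj X)) ≪≫
    @asIso _ _ _ _ (biproduct.π (fun i : s => (hodgeClassesFunctor p).obj ((ofPure (i : ℤ)).obj ((gr (i : ℤ)).obj X))) ⟨2 * p, hp⟩)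
      (isIso_biproduct_π_of_isZero' _ _ fun _ hi => isZero_hodgeClassesFunctor_obj_ofPure_gr_of_ne (fun h => hi (Subtype.ext h)) X)

/-- `hodgeClassesGrTotalObjIso = Hdgᵖ(π_{2p})`. [cite: Arapura2022, §1 Lemma 1.1] -/
theorem hodgeClassesGrTotalObjIso_hom (p : ℤ) (hp : 2 * p ∈ s) (X : MixedHodgeStructureCat.{u}) :
    (hodgeClassesGrTotalObjIso s p hp X).hom = (hodgeClassesFunctor p).map ((grTotalπ s ⟨2 * p, hp⟩).app X) :=
  biproduct.lift_π _ _

/-- **The comparison `Hdgᵖ ⟶ grTotal s ⋙ Hdgᵖ` (`2p ∈ s`)**: `Hdgᵖ(X) → Hdgᵖ((ofPure 2p)(Gr^W_{2p} X)) → Hdgᵖ((grTotal s) X)`, the class `[v] ∈ Gr^W_{2p}`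
placed in the `2p`-summand. [cite: Arapura2022, §1 Lemma 1.1] [cite: CattaniElZeinGriffithsLe2014, Ex. 3.2.23 (2)] -/
def hodgeClassesToGrTotal (p : ℤ) (hp : 2 * p ∈ s) : hodgeClassesFunctor.{u} p ⟶ grTotal s ⋙ hodgeClassesFunctor p :=
  hodgeClassesToGr p ≫ Functor.whiskerRight (grTotalι s ⟨2 * p, hp⟩) (hodgeClassesFunctor p)

/-- The components of `hodgeClassesToGrTotal`. [cite: Arapura2022, §1 Lemma 1.1] -/
theorem hodgeClassesToGrTotal_app (p : ℤ) (hp : 2 * p ∈ s) (X : MixedHodgeStructureCat.{u}) :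
    (hodgeClassesToGrTotal s p hp).app X = (hodgeClassesToGr p).app X ≫ (hodgeClassesFunctor p).map ((grTotalι s ⟨2 * p, hp⟩).app X) := rfl

/-- `hodgeClassesToGrTotal_X ≫ Hdgᵖ(π_{2p}) = hodgeClassesToGr_X`. [cite: Arapura2022, §1 Lemma 1.1] -/
theorem hodgeClassesToGrTotal_app_comp (p : ℤ) (hp : 2 * p ∈ s) (X : MixedHodgeStructureCat.{u}) :
    (hodgeClassesToGrTotal s p hp).app X ≫ (hodgeClassesFunctor p).map ((grTotalπ s ⟨2 * p, hp⟩).app X) = (hodgeClassesToGr p).app X := by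
  have h : (hodgeClassesFunctor p).map ((grTotalι s ⟨2 * p, hp⟩).app X) ≫ (hodgeClassesFunctor p).map ((grTotalπ s ⟨2 * p, hp⟩).app X) =
      𝟙 ((hodgeClassesFunctor p).obj ((gr (2 * p) ⋙ ofPure (2 * p)).obj X)) := by
    rw [← (hodgeClassesFunctor p).map_comp]
    change (hodgeClassesFunctor p).map ((grTotalι s ⟨2 * p, hp⟩ ≫ grTotalπ s ⟨2 * p, hp⟩).app X) = _
    rw [grTotalι_comp_grTotalπ]
    exact (hodgeClassesFunctor p).map_id _
  exact (Category.assoc _ _ _).trans ((congrArg (fun t => (hodgeClassesToGr p).app X ≫ t) h).trans (Category.comp_id _))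

/-- **`Hdgᵖ(X) ↪ Hdgᵖ((grTotal s) X)` is a monomorphism**: the associated weight-graded object has at least the Hodge classes of `X`.
[cite: Arapura2022, §1 Lemma 1.1] -/
theorem mono_hodgeClassesToGrTotal_app (p : ℤ) (hp : 2 * p ∈ s) (X : MixedHodgeStructureCat.{u}) : Mono ((hodgeClassesToGrTotal s p hp).app X) :=
  haveI : @Mono _ _ ((hodgeClassesFunctor p).obj X) ((hodgeClassesFunctor p).obj ((gr (2 * p) ⋙ ofPure (2 * p)).obj X))
      ((hodgeClassesToGr p).app X) := mono_hodgeClassesToGr_app p X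
  mono_of_mono_fac (hodgeClassesToGrTotal_app_comp s p hp X)

/-- `hodgeClassesToGrTotal` is a monomorphism of functors. [cite: Arapura2022, §1 Lemma 1.1] -/
theorem mono_hodgeClassesToGrTotal (p : ℤ) (hp : 2 * p ∈ s) : Mono (hodgeClassesToGrTotal.{u} s p hp) :=
  haveI := fun X => mono_hodgeClassesToGrTotal_app.{u} s p hp X
  NatTrans.mono_of_mono_app _

/-- **`Hdgᵖ(X) ⥲ Hdgᵖ((grTotal s) X)` when `W_{2p-1} X = 0`** (then `Hdgᵖ(X) ⥲ Hdgᵖ(Gr^W_{2p} X)`, g43 `isIso_hodgeClassesToGr_app`).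
[cite: Arapura2022, §1 Lemma 1.1] -/
theorem isIso_hodgeClassesToGrTotal_app (p : ℤ) (hp : 2 * p ∈ s) {X : MixedHodgeStructureCat.{u}} (h : X.str.W (2 * p - 1) = ⊥) :
    IsIso ((hodgeClassesToGrTotal s p hp).app X) := by
  have hπ : IsIso ((hodgeClassesFunctor p).map ((grTotalπ s ⟨2 * p, hp⟩).app X)) := by
    rw [← hodgeClassesGrTotalObjIso_hom]
    infer_instance
  haveI : @IsIso _ _ ((grTotal s ⋙ hodgeClassesFunctor p).obj X) ((hodgeClassesFunctor p).obj ((gr (2 * p) ⋙ ofPure (2 * p)).obj X))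
      ((hodgeClassesFunctor p).map ((grTotalπ s ⟨2 * p, hp⟩).app X)) := hπ
  haveI : @IsIso _ _ ((hodgeClassesFunctor p).obj X) ((hodgeClassesFunctor p).obj ((gr (2 * p) ⋙ ofPure (2 * p)).obj X))
      ((hodgeClassesToGr p).app X) := isIso_hodgeClassesToGr_app p h
  exact IsIso.of_isIso_fac_right (hodgeClassesToGrTotal_app_comp s p hp X)

end

end MixedHodgeStructureCat

end Literature.AlgebraicGeometry.Motives

end
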